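import Literature.Probability.RandomPlanarGeometry.LoopWinding
import HarnessLib

/-!
# Routing-blind closeness of planar loops and of typed loop configurations

A companion of `LoopConfigurations` (DKKMO's `d_CN`, arXiv:2012.11672v2 §1.2, eq. (1)–(2)) in which
the loop distance `d(γ, γ') ≤ ε` of eq. (1) (`UnbasedLoop.udist`, an infimum over one-to-one
parametrisations) is replaced by the **routing-blind** relation `BlindNear ε γ γ'`:

* the traces are at Hausdorff distance `≤ ε`, and
* the winding *interiors* `{z | W(γ, z) ≠ 0}` and `{z | W(γ', z) ≠ 0}` agree off the closed
  `ε`-neighbourhood of the two traces.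

`BlindNear` sees a loop only through the pair (trace, interior): orientation, covering
multiplicity and the *routing* chosen at pinch points (two non-crossing re-routings of one trace
with the same interior) are invisible to it, whereas `d` separates them. Everything else is kept
exactly as printed by DKKMO: the soft window `B(0, 1/ε)`, the two types `F₀`, `F₁`, both
directions of the matching (`LoopConfig.IsBlindClose`, the blind form of the display before
eq. (1)), and the coupling distance of laws (`LoopConfig.blindLawEDist`, the blind form of
eq. (2)).

## Contents

* `BlindNear ε u u'` and its API: symmetry (`BlindNear.symm`), monotonicity in `ε`
  (`BlindNear.mono`), reflexivity, invisibility of orientation (`blindNear_reverse_left/right`),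
  the triangle inequality `BlindNear ε u v → BlindNear ε' v w → BlindNear (ε + ε') u w`
  (`BlindNear.trans`, for `0 ≤ ε, ε'`), equal traces and interiors are blind-close at every
  precision (`blindNear_of_range_eq_of_setOf_wind_eq`), and **`d(u, u') ≤ ε ⇒ BlindNear ε u u'`**
  (`blindNear_of_udist_le`: the Hausdorff distance of the traces is dominated by `d`, and off the
  `ε`-collar of the trace the winding numbers agree up to a global sign,
  `UnbasedLoop.wind_eq_or_eq_neg_of_udist_lt`).
* `LoopConfig.IsBlindClose ε F F'` — `LoopConfig.IsClose` with `udist ≤ ε` replaced by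
  `BlindNear ε`; `IsClose ε ⇒ IsBlindClose ε` (`IsBlindClose.of_isClose`), symmetry, reflexivity,
  monotonicity, the restricted triangle inequality `IsBlindClose.trans` (for `ε + ε' ≤ 1`, same
  window arithmetic as `IsClose.trans`), and `isBlindClose_of_forall_exists_eq` (configurations
  whose loops correspond type by type with equal traces and equal interiors are blind-close at
  every precision).
* `LoopConfig.blindLawEDist μ X μ' X'` — `LoopConfig.cnLawEDist` with `IsClose` replaced by
  `IsBlindClose`; `blindLawEDist_le_of_coupling`, `exists_coupling_of_blindLawEDist_lt`,
  `blindLawEDist_le_iff_forall_lt`, `blindLawEDist_comm`, and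
  **`blindLawEDist ≤ cnLawEDist`** (`blindLawEDist_le_cnLawEDist`).

These notions are not in DKKMO; they are the harness's routing-blind weakening of `d_CN`, built
from standard ingredients (Hausdorff distance, winding-number interiors), and are tagged
`[folklore]`. Only the plane `ℂ` is treated (winding numbers).

## References

* H. Duminil-Copin, K. K. Kozlowski, D. Krachun, I. Manolescu, M. Oulamara, arXiv:2012.11672v2
  (2026), §1.2: the display defining `d_CN ≤ ε`, eq. (1), eq. (2) (the template modified here).
* F. Camia, C. M. Newman, Comm. Math. Phys. 268 (2006), §2.2 (distances on loop collections).
-/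

noncomputable section

open Set
open _root_.MeasureTheory
open scoped ENNReal

namespace Literature.Probability.RandomPlanarGeometry

/-! ### Blind closeness of two loops -/

/-- **Blind closeness of two planar loops at precision `ε`**: the Hausdorff (extended) distance of
the traces is `≤ ε`, and the winding interiors `{z | W(u, z) ≠ 0}`, `{z | W(u', z) ≠ 0}` agree off
the closed `ε`-neighbourhood of the union of the two traces (their symmetric difference lies in
`Metric.cthickening ε (trace u ∪ trace u')`). Orientation, covering multiplicity and the routing at
pinch points are invisible to this relation. The routing-blind substitute for DKKMO's
`d(γ, γ') ≤ ε` (arXiv:2012.11672v2, eq. (1)); for `ε < 0` it coincides with precision `0`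
(`ENNReal.ofReal ε = 0`, `cthickening ε = closure`). [folklore] -/
def BlindNear (ε : ℝ) (u u' : UnbasedLoop ℂ) : Prop :=
  Metric.hausdorffEDist u.range u'.range ≤ ENNReal.ofReal ε ∧
    symmDiff {z : ℂ | u.wind z ≠ 0} {z : ℂ | u'.wind z ≠ 0} ⊆ Metric.cthickening ε (u.range ∪ u'.range)

/-- Unfolding `BlindNear`. [folklore] -/
theorem blindNear_iff {ε : ℝ} {u u' : UnbasedLoop ℂ} :
    BlindNear ε u u' ↔ Metric.hausdorffEDist u.range u'.range ≤ ENNReal.ofReal ε ∧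
      symmDiff {z : ℂ | u.wind z ≠ 0} {z : ℂ | u'.wind z ≠ 0} ⊆
        Metric.cthickening ε (u.range ∪ u'.range) :=
  Iff.rfl

/-- Blind closeness is symmetric. [folklore] -/
theorem BlindNear.symm {ε : ℝ} {u u' : UnbasedLoop ℂ} (h : BlindNear ε u u') : BlindNear ε u' u := by
  refine ⟨?_, ?_⟩
  · rw [Metric.hausdorffEDist_comm]; exact h.1
  · rw [symmDiff_comm, union_comm]; exact h.2

/-- Blind closeness is symmetric. [folklore] -/
theorem blindNear_comm {ε : ℝ} {u u' : UnbasedLoop ℂ} : BlindNear ε u u' ↔ BlindNear ε u' u :=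
  ⟨BlindNear.symm, BlindNear.symm⟩

/-- Loops with equal traces and equal winding interiors are blind-close at every precision (this
is exactly what the relation forgets: e.g. two non-crossing re-routings of one trace with the same
interior, or a circle and the same circle covered twice). [folklore] -/
theorem blindNear_of_range_eq_of_setOf_wind_eq {ε : ℝ} {u u' : UnbasedLoop ℂ}
    (hr : u'.range = u.range) (hw : {z | u'.wind z ≠ 0} = {z | u.wind z ≠ 0}) :
    BlindNear ε u u' := by
  refine ⟨?_, ?_⟩
  · rw [hr, Metric.hausdorffEDist_self]; exact bot_le
  · rw [hw, symmDiff_self]; exact empty_subset _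

/-- Every loop is blind-close to itself at every precision. [folklore] -/
@[simp] theorem blindNear_self (ε : ℝ) (u : UnbasedLoop ℂ) : BlindNear ε u u :=
  blindNear_of_range_eq_of_setOf_wind_eq rfl rfl

/-- Monotonicity in the precision. [folklore] -/
theorem BlindNear.mono {ε ε' : ℝ} (hle : ε ≤ ε') {u u' : UnbasedLoop ℂ} (h : BlindNear ε u u') :
    BlindNear ε' u u' :=
  ⟨h.1.trans (ENNReal.ofReal_le_ofReal hle), h.2.trans (Metric.cthickening_mono hle _)⟩

/-- Blind closeness does not see the orientation of its first argument (time reversal keeps the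
trace and negates the winding number, so it keeps the interior; cf.
`UnbasedLoop.setOf_wind_reverse_ne_zero` in `NestingTransform`). [folklore] -/
@[simp] theorem blindNear_reverse_left {ε : ℝ} {u u' : UnbasedLoop ℂ} :
    BlindNear ε u.reverse u' ↔ BlindNear ε u u' := by
  have h : {z | u.reverse.wind z ≠ 0} = {z | u.wind z ≠ 0} := by
    ext z
    simp [UnbasedLoop.wind_reverse]
  rw [BlindNear, BlindNear, UnbasedLoop.range_reverse, h]

/-- Blind closeness does not see the orientation of its second argument. [folklore] -/
@[simp] theorem blindNear_reverse_right {ε : ℝ} {u u' : UnbasedLoop ℂ} :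
    BlindNear ε u u'.reverse ↔ BlindNear ε u u' := by
  rw [blindNear_comm, blindNear_reverse_left, blindNear_comm]

/-- The real Hausdorff distance of the traces of blind-close loops is `≤ ε` (traces are compact and
nonempty, so the extended distance is finite). [folklore] -/
theorem BlindNear.hausdorffDist_le {ε : ℝ} (hε : 0 ≤ ε) {u u' : UnbasedLoop ℂ} (h : BlindNear ε u u') :
    Metric.hausdorffDist u.range u'.range ≤ ε := by
  rw [Metric.hausdorffDist, ← ENNReal.toReal_ofReal hε]
  exact (ENNReal.toReal_le_toReal
    (Metric.hausdorffEDist_ne_top_of_nonempty_of_bounded u.range_nonempty u'.range_nonempty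
      u.isCompact_range.isBounded u'.isCompact_range.isBounded) ENNReal.ofReal_ne_top).2 h.1

/-- Every point of the trace of `u'` is within `ε` of a point of the trace of `u` when the two loops
are blind-close at precision `ε ≥ 0`. [folklore] -/
theorem BlindNear.exists_mem_range_dist_le {ε : ℝ} (hε : 0 ≤ ε) {u u' : UnbasedLoop ℂ}
    (h : BlindNear ε u u') {x : ℂ} (hx : x ∈ u'.range) : ∃ y ∈ u.range, dist x y ≤ ε := by
  obtain ⟨y, hy, hxy⟩ := u.isCompact_range.exists_infDist_eq_dist u.range_nonempty x
  refine ⟨y, hy, ?_⟩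
  rw [← hxy, Metric.infDist, ← ENNReal.toReal_ofReal hε]
  refine (ENNReal.toReal_le_toReal (Metric.infEDist_ne_top u.range_nonempty) ENNReal.ofReal_ne_top).2 ?_
  calc Metric.infEDist x u.range ≤ Metric.hausdorffEDist u'.range u.range :=
        Metric.infEDist_le_hausdorffEDist_of_mem hx
    _ = Metric.hausdorffEDist u.range u'.range := Metric.hausdorffEDist_comm
    _ ≤ ENNReal.ofReal ε := h.1

/-- A loop blind-close at precision `ε ≥ 0` to a loop inside `B(0, r)` lies inside `B(0, r + ε)`
(the blind analogue of `UnbasedLoop.range_subset_ball_of_udist_le`). [folklore] -/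
theorem BlindNear.range_subset_ball {ε r : ℝ} (hε : 0 ≤ ε) {u u' : UnbasedLoop ℂ}
    (h : BlindNear ε u u') (hr : u.range ⊆ Metric.ball (0 : ℂ) r) :
    u'.range ⊆ Metric.ball (0 : ℂ) (r + ε) := by
  intro x hx
  obtain ⟨y, hy, hxy⟩ := h.exists_mem_range_dist_le hε hx
  have hy' := hr hy
  rw [Metric.mem_ball, dist_zero_right] at hy' ⊢
  calc ‖x‖ = ‖y + (x - y)‖ := by rw [add_sub_cancel]
    _ ≤ ‖y‖ + ‖x - y‖ := norm_add_le _ _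
    _ < r + ε := add_lt_add_of_lt_of_le hy' (by rwa [← dist_eq_norm])

/-- **Triangle inequality for blind closeness**: `BlindNear ε u v` and `BlindNear ε' v w` give
`BlindNear (ε + ε') u w` (for `0 ≤ ε, ε'`). The Hausdorff distances add; a point where the
interiors of `u` and `w` differ is a point where those of `u`, `v` or of `v`, `w` differ, hence is
within `ε` of `trace u ∪ trace v` or within `ε'` of `trace v ∪ trace w`, and `trace v` is itself
within `ε'` of `trace w` and within `ε` of `trace u`. [folklore] -/
theorem BlindNear.trans {ε ε' : ℝ} (hε : 0 ≤ ε) (hε' : 0 ≤ ε') {u v w : UnbasedLoop ℂ}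
    (h : BlindNear ε u v) (h' : BlindNear ε' v w) : BlindNear (ε + ε') u w := by
  have hadd : ENNReal.ofReal ε + ENNReal.ofReal ε' = ENNReal.ofReal (ε + ε') :=
    (ENNReal.ofReal_add hε hε').symm
  refine ⟨?_, ?_⟩
  · calc Metric.hausdorffEDist u.range w.range
        ≤ Metric.hausdorffEDist u.range v.range + Metric.hausdorffEDist v.range w.range :=
          Metric.hausdorffEDist_triangle
      _ ≤ ENNReal.ofReal ε + ENNReal.ofReal ε' := add_le_add h.1 h'.1
      _ = ENNReal.ofReal (ε + ε') := hadd
  · intro z hz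
    rw [Metric.mem_cthickening_iff, Metric.infEDist_union, inf_le_iff]
    have hle : ENNReal.ofReal ε ≤ ENNReal.ofReal (ε + ε') := ENNReal.ofReal_le_ofReal (by linarith)
    have hle' : ENNReal.ofReal ε' ≤ ENNReal.ofReal (ε + ε') := ENNReal.ofReal_le_ofReal (by linarith)
    rcases (symmDiff_triangle {z : ℂ | u.wind z ≠ 0} {z : ℂ | v.wind z ≠ 0} {z : ℂ | w.wind z ≠ 0}) hz
      with hz' | hz'
    · have h₁ := h.2 hz'
      rw [Metric.mem_cthickening_iff, Metric.infEDist_union, inf_le_iff] at h₁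
      rcases h₁ with h₁ | h₁
      · exact Or.inl (h₁.trans hle)
      · right
        calc Metric.infEDist z w.range
            ≤ Metric.infEDist z v.range + Metric.hausdorffEDist v.range w.range :=
              Metric.infEDist_le_infEDist_add_hausdorffEDist
          _ ≤ ENNReal.ofReal ε + ENNReal.ofReal ε' := add_le_add h₁ h'.1
          _ = ENNReal.ofReal (ε + ε') := hadd
    · have h₁ := h'.2 hz'
      rw [Metric.mem_cthickening_iff, Metric.infEDist_union, inf_le_iff] at h₁
      rcases h₁ with h₁ | h₁
      · left
        calc Metric.infEDist z u.range
            ≤ Metric.infEDist z v.range + Metric.hausdorffEDist v.range u.range :=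
              Metric.infEDist_le_infEDist_add_hausdorffEDist
          _ ≤ ENNReal.ofReal ε' + ENNReal.ofReal ε :=
              add_le_add h₁ (by rw [Metric.hausdorffEDist_comm]; exact h.1)
          _ = ENNReal.ofReal (ε + ε') := by rw [add_comm, hadd]
      · exact Or.inr (h₁.trans hle')

/-! ### `d`-closeness implies blind closeness -/

/-- **A loop at DKKMO distance `d(u, u') ≤ ε` is blind-close at precision `ε`**: the Hausdorff
distance of the traces is dominated by `d` (`UnbasedLoop.hausdorffDist_range_le_udist`), and at a
point at distance `> ε` from the trace of `u` the winding numbers of `u'` and `u` agree up to a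
global sign (`UnbasedLoop.wind_eq_or_eq_neg_of_udist_lt`), so the interiors `{W ≠ 0}` agree there.
[folklore] -/
theorem blindNear_of_udist_le {ε : ℝ} {u u' : UnbasedLoop ℂ} (h : u.udist u' ≤ ε) :
    BlindNear ε u u' := by
  have hε : 0 ≤ ε := (UnbasedLoop.udist_nonneg u u').trans h
  refine ⟨?_, ?_⟩
  · have hfin : Metric.hausdorffEDist u.range u'.range ≠ ⊤ :=
      Metric.hausdorffEDist_ne_top_of_nonempty_of_bounded u.range_nonempty u'.range_nonempty
        u.isCompact_range.isBounded u'.isCompact_range.isBounded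
    have hreal : Metric.hausdorffDist u.range u'.range ≤ ε :=
      (UnbasedLoop.hausdorffDist_range_le_udist u u').trans h
    rw [← ENNReal.ofReal_toReal hfin]
    exact ENNReal.ofReal_le_ofReal hreal
  · intro z hz
    by_contra hzt
    rw [Metric.mem_cthickening_iff, not_le, Metric.infEDist_union, lt_inf_iff] at hzt
    have hzu : ε < Metric.infDist z u.range := by
      have hne : Metric.infEDist z u.range ≠ ⊤ := Metric.infEDist_ne_top u.range_nonempty
      rw [Metric.infDist, ← ENNReal.toReal_ofReal hε]
      exact (ENNReal.toReal_lt_toReal ENNReal.ofReal_ne_top hne).2 hzt.1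
    have hw := UnbasedLoop.wind_eq_or_eq_neg_of_udist_lt (h.trans_lt hzu)
    have hiff : (u.wind z ≠ 0 ↔ u'.wind z ≠ 0) := by
      rcases hw with hw | hw <;> simp [hw]
    simp only [mem_symmDiff, mem_setOf_eq] at hz
    tauto

/-! ### Blind closeness of typed loop configurations -/

namespace LoopConfig

/-- **The routing-blind analogue of DKKMO's relation `d_CN(F, F') ≤ ε`** (`LoopConfig.IsClose`
with `d(γ, γ') ≤ ε` replaced by `BlindNear ε γ γ'`; same soft window `B(0, 1/ε)`, same types, both
directions): every loop of either configuration lying in the open ball `B(0, 1/ε)` has a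
blind-close loop *of the same type* in the other configuration. [folklore] -/
def IsBlindClose (ε : ℝ) (c c' : LoopConfig ℂ) : Prop :=
  ∀ i : Fin 2,
    (∀ u ∈ c.F i, u.range ⊆ Metric.ball (0 : ℂ) (1 / ε) → ∃ u' ∈ c'.F i, BlindNear ε u u') ∧
    (∀ u' ∈ c'.F i, u'.range ⊆ Metric.ball (0 : ℂ) (1 / ε) → ∃ u ∈ c.F i, BlindNear ε u' u)

/-- Unfolding `IsBlindClose`. [folklore] -/
theorem isBlindClose_iff {ε : ℝ} {c c' : LoopConfig ℂ} :
    IsBlindClose ε c c' ↔ ∀ i : Fin 2,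
      (∀ u ∈ c.F i, u.range ⊆ Metric.ball (0 : ℂ) (1 / ε) → ∃ u' ∈ c'.F i, BlindNear ε u u') ∧
      (∀ u' ∈ c'.F i, u'.range ⊆ Metric.ball (0 : ℂ) (1 / ε) → ∃ u ∈ c.F i, BlindNear ε u' u) :=
  Iff.rfl

/-- **`d_CN(F, F') ≤ ε` implies blind closeness at precision `ε`** (same partners,
`blindNear_of_udist_le`). [folklore] -/
theorem IsBlindClose.of_isClose {ε : ℝ} {c c' : LoopConfig ℂ} (h : IsClose ε c c') :
    IsBlindClose ε c c' := by
  intro i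
  refine ⟨fun u hu hr ↦ ?_, fun u' hu' hr ↦ ?_⟩
  · obtain ⟨u', hu', hd⟩ := (h i).1 u hu hr
    exact ⟨u', hu', blindNear_of_udist_le hd⟩
  · obtain ⟨u, hu, hd⟩ := (h i).2 u' hu' hr
    exact ⟨u, hu, blindNear_of_udist_le hd⟩

/-- Blind closeness of configurations is symmetric. [folklore] -/
theorem IsBlindClose.symm {ε : ℝ} {c c' : LoopConfig ℂ} (h : IsBlindClose ε c c') :
    IsBlindClose ε c' c :=
  fun i ↦ ⟨(h i).2, (h i).1⟩

/-- Blind closeness of configurations is symmetric. [folklore] -/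
theorem isBlindClose_comm {ε : ℝ} {c c' : LoopConfig ℂ} : IsBlindClose ε c c' ↔ IsBlindClose ε c' c :=
  ⟨IsBlindClose.symm, IsBlindClose.symm⟩

/-- Every configuration is blind-close to itself at every precision. [folklore] -/
theorem isBlindClose_self (ε : ℝ) (c : LoopConfig ℂ) : IsBlindClose ε c c :=
  fun _ ↦ ⟨fun u hu _ ↦ ⟨u, hu, blindNear_self ε u⟩, fun u hu _ ↦ ⟨u, hu, blindNear_self ε u⟩⟩

/-- Monotonicity: for `0 < ε ≤ ε'`, blind closeness at precision `ε` implies blind closeness at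
precision `ε'` (the window `B(0, 1/ε)` shrinks and the tolerance grows). [folklore] -/
theorem IsBlindClose.mono {ε ε' : ℝ} (hε : 0 < ε) (hle : ε ≤ ε') {c c' : LoopConfig ℂ}
    (h : IsBlindClose ε c c') : IsBlindClose ε' c c' := by
  have hball : Metric.ball (0 : ℂ) (1 / ε') ⊆ Metric.ball 0 (1 / ε) :=
    Metric.ball_subset_ball (one_div_le_one_div_of_le hε hle)
  intro i
  refine ⟨fun u hu hr ↦ ?_, fun u' hu' hr ↦ ?_⟩
  · obtain ⟨u', hu', hd⟩ := (h i).1 u hu (hr.trans hball)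
    exact ⟨u', hu', hd.mono hle⟩
  · obtain ⟨u, hu, hd⟩ := (h i).2 u' hu' (hr.trans hball)
    exact ⟨u, hu, hd.mono hle⟩

/-- Reversing members does not affect blind closeness: if every member of `c₁` is a member of `c`
up to orientation and conversely, then `c₁` is as blind-close to `c'` as `c` is. [folklore] -/
theorem IsBlindClose.of_forall_mem_or_reverse_mem {ε : ℝ} {c c₁ c' : LoopConfig ℂ}
    (h : IsBlindClose ε c c') (h₁ : ∀ i, ∀ u ∈ c₁.F i, u ∈ c.F i ∨ u.reverse ∈ c.F i)
    (h₂ : ∀ i, ∀ u ∈ c.F i, u ∈ c₁.F i ∨ u.reverse ∈ c₁.F i) : IsBlindClose ε c₁ c' := by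
  intro i
  refine ⟨fun u hu hr ↦ ?_, fun u' hu' hr ↦ ?_⟩
  · rcases h₁ i u hu with hu₀ | hu₀
    · exact (h i).1 u hu₀ hr
    · obtain ⟨u', hu', hd⟩ := (h i).1 u.reverse hu₀ (by rwa [UnbasedLoop.range_reverse])
      exact ⟨u', hu', by rwa [blindNear_reverse_left] at hd⟩
  · obtain ⟨u, hu, hd⟩ := (h i).2 u' hu' hr
    rcases h₂ i u hu with hu₁ | hu₁
    · exact ⟨u, hu₁, hd⟩
    · exact ⟨u.reverse, hu₁, by rwa [blindNear_reverse_right]⟩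

/-- **What blind closeness forgets**: configurations whose loops correspond type by type with
*equal traces and equal winding interiors* are blind-close at every precision `ε` — e.g. two
configurations differing by the re-routing of a loop at an interleaved pair of pinch points, which
`d_CN` separates. [folklore] -/
theorem isBlindClose_of_forall_exists_eq {ε : ℝ} {c c' : LoopConfig ℂ}
    (h₁ : ∀ i, ∀ u ∈ c.F i, ∃ u' ∈ c'.F i,
      u'.range = u.range ∧ {z | u'.wind z ≠ 0} = {z | u.wind z ≠ 0})
    (h₂ : ∀ i, ∀ u' ∈ c'.F i, ∃ u ∈ c.F i,
      u.range = u'.range ∧ {z | u.wind z ≠ 0} = {z | u'.wind z ≠ 0}) :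
    IsBlindClose ε c c' := by
  intro i
  refine ⟨fun u hu _ ↦ ?_, fun u' hu' _ ↦ ?_⟩
  · obtain ⟨u', hu', hr, hw⟩ := h₁ i u hu
    exact ⟨u', hu', blindNear_of_range_eq_of_setOf_wind_eq hr hw⟩
  · obtain ⟨u, hu, hr, hw⟩ := h₂ i u' hu'
    exact ⟨u, hu, blindNear_of_range_eq_of_setOf_wind_eq hr hw⟩

/-- **Restricted triangle inequality for blind closeness of configurations.** If `F`, `F'` are
blind-close at precision `ε`, `F'`, `F''` at precision `ε'`, and `ε + ε' ≤ 1`, then `F`, `F''` are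
blind-close at precision `ε + ε'`: a loop of `F` inside `B(0, 1/(ε + ε'))` has a blind-close
partner in `F'`, which lies inside `B(0, 1/(ε + ε') + ε) ⊆ B(0, 1/ε')` *because*
`ε' (ε + ε') ≤ 1` (`BlindNear.range_subset_ball`), hence has a partner in `F''`, and blind
closeness of loops is sub-additive (`BlindNear.trans`). Same window arithmetic and smallness
condition as `IsClose.trans`. [folklore] -/
theorem IsBlindClose.trans {ε ε' : ℝ} (hε : 0 < ε) (hε' : 0 < ε') (h1 : ε + ε' ≤ 1)
    {c c' c'' : LoopConfig ℂ} (h : IsBlindClose ε c c') (h' : IsBlindClose ε' c' c'') :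
    IsBlindClose (ε + ε') c c'' := by
  -- window arithmetic: `1/(a+b) + a ≤ 1/b` when `0 < a, b` and `a + b ≤ 1`
  have key : ∀ {a b : ℝ}, 0 < a → 0 < b → a + b ≤ 1 → 1 / (a + b) + a ≤ 1 / b := by
    intro a b ha hb hab
    rw [div_add' _ _ _ (add_pos ha hb).ne', div_le_div_iff₀ (add_pos ha hb) hb]
    nlinarith [mul_pos ha hb, mul_pos ha ha]
  have hw₁ : Metric.ball (0 : ℂ) (1 / (ε + ε') + ε) ⊆ Metric.ball 0 (1 / ε') :=
    Metric.ball_subset_ball (key hε hε' h1)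
  have hw₂ : Metric.ball (0 : ℂ) (1 / (ε + ε') + ε') ⊆ Metric.ball 0 (1 / ε) := by
    refine Metric.ball_subset_ball ?_
    have := key hε' hε (by linarith)
    rwa [add_comm ε' ε] at this
  intro i
  refine ⟨fun u hu hr ↦ ?_, fun u'' hu'' hr ↦ ?_⟩
  · have hball : Metric.ball (0 : ℂ) (1 / (ε + ε')) ⊆ Metric.ball 0 (1 / ε) :=
      Metric.ball_subset_ball (one_div_le_one_div_of_le hε (by linarith))
    obtain ⟨u', hu', hd⟩ := (h i).1 u hu (hr.trans hball)
    obtain ⟨u'', hu'', hd'⟩ := (h' i).1 u' hu' ((hd.range_subset_ball hε.le hr).trans hw₁)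
    exact ⟨u'', hu'', hd.trans hε.le hε'.le hd'⟩
  · have hball : Metric.ball (0 : ℂ) (1 / (ε + ε')) ⊆ Metric.ball 0 (1 / ε') :=
      Metric.ball_subset_ball (one_div_le_one_div_of_le hε' (by linarith))
    obtain ⟨u', hu', hd'⟩ := (h' i).2 u'' hu'' (hr.trans hball)
    obtain ⟨u, hu, hd⟩ := (h i).2 u' hu' ((hd'.range_subset_ball hε'.le hr).trans hw₂)
    refine ⟨u, hu, ?_⟩
    rw [add_comm]
    exact hd'.trans hε'.le hε.le hd

/-! ### The blind coupling distance on laws -/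

section Law

variable {Ω Ω' : Type*} [MeasurableSpace Ω] [MeasurableSpace Ω']

/-- **The routing-blind coupling distance between the laws of two random loop configurations**:
DKKMO's eq. (2) (`LoopConfig.cnLawEDist`) with the event `d_CN(ω, ω') > ε` replaced by the failure
of blind closeness `¬ IsBlindClose ε`. The random configurations are `X : Ω → LoopConfig ℂ` under
`μ` and `X' : Ω' → LoopConfig ℂ` under `μ'`; a coupling is a measure `P` on `Ω × Ω'` with marginals
`μ`, `μ'`; the bad event is measured by the outer measure `P`. Values in `[0, ∞]`. [folklore] -/
def blindLawEDist (μ : Measure Ω) (X : Ω → LoopConfig ℂ) (μ' : Measure Ω')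
    (X' : Ω' → LoopConfig ℂ) : ℝ≥0∞ :=
  ⨅ (ε : ℝ) (_ : 0 < ε) (P : Measure (Ω × Ω')) (_ : P.map Prod.fst = μ) (_ : P.map Prod.snd = μ')
    (_ : P {p | ¬ IsBlindClose ε (X p.1) (X' p.2)} < ENNReal.ofReal ε), ENNReal.ofReal ε

variable {μ : Measure Ω} {X : Ω → LoopConfig ℂ} {μ' : Measure Ω'} {X' : Ω' → LoopConfig ℂ}

/-- A coupling with `P[¬ IsBlindClose ε] < ε` witnesses `blindLawEDist ≤ ε`. [folklore] -/
theorem blindLawEDist_le_of_coupling {ε : ℝ} (hε : 0 < ε) (P : Measure (Ω × Ω'))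
    (h₁ : P.map Prod.fst = μ) (h₂ : P.map Prod.snd = μ')
    (hP : P {p | ¬ IsBlindClose ε (X p.1) (X' p.2)} < ENNReal.ofReal ε) :
    blindLawEDist μ X μ' X' ≤ ENNReal.ofReal ε :=
  (iInf_le _ ε).trans <| (iInf_le _ hε).trans <| (iInf_le _ P).trans <| (iInf_le _ h₁).trans <|
    (iInf_le _ h₂).trans <| iInf_le _ hP

/-- If `blindLawEDist < ε` then there is a coupling with `P[¬ IsBlindClose ε] < ε` (the set of
admissible `ε` is an up-set, by `IsBlindClose.mono`). [folklore] -/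
theorem exists_coupling_of_blindLawEDist_lt {ε : ℝ}
    (h : blindLawEDist μ X μ' X' < ENNReal.ofReal ε) :
    ∃ P : Measure (Ω × Ω'), P.map Prod.fst = μ ∧ P.map Prod.snd = μ' ∧
      P {p | ¬ IsBlindClose ε (X p.1) (X' p.2)} < ENNReal.ofReal ε := by
  simp only [blindLawEDist, iInf_lt_iff] at h
  obtain ⟨ε₀, hε₀, P, h₁, h₂, hP, hlt⟩ := h
  have hle : ε₀ ≤ ε := (ENNReal.ofReal_lt_ofReal_iff'.1 hlt).1.le
  refine ⟨P, h₁, h₂, (measure_mono ?_).trans_lt (hP.trans_le (ENNReal.ofReal_le_ofReal hle))⟩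
  exact fun p hp hc ↦ hp (hc.mono hε₀ hle)

/-- **Sublevel sets of the blind coupling distance**: for `0 ≤ r`, `blindLawEDist ≤ r` iff for
every `ε > r` there is a coupling `P` of the two laws with `P[¬ IsBlindClose ε] < ε`. [folklore] -/
theorem blindLawEDist_le_iff_forall_lt {r : ℝ} (hr : 0 ≤ r) :
    blindLawEDist μ X μ' X' ≤ ENNReal.ofReal r ↔
      ∀ ε : ℝ, r < ε → ∃ P : Measure (Ω × Ω'), P.map Prod.fst = μ ∧ P.map Prod.snd = μ' ∧
        P {p | ¬ IsBlindClose ε (X p.1) (X' p.2)} < ENNReal.ofReal ε := by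
  constructor
  · intro h ε hε
    exact exists_coupling_of_blindLawEDist_lt
      (h.trans_lt (ENNReal.ofReal_lt_ofReal_iff'.2 ⟨hε, hr.trans_lt hε⟩))
  · intro h
    refine ENNReal.le_of_forall_pos_le_add fun η hη _ ↦ ?_
    have hη' : (0 : ℝ) < η := by exact_mod_cast hη
    rw [← ENNReal.ofReal_coe_nnreal, ← ENNReal.ofReal_add hr hη'.le]
    obtain ⟨P, h₁, h₂, hP⟩ := h (r + η) (by linarith)
    exact blindLawEDist_le_of_coupling (by linarith) P h₁ h₂ hP

/-- One direction of the symmetry of the blind coupling distance (swap the coupling). [folklore] -/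
theorem blindLawEDist_comm_le (μ : Measure Ω) (X : Ω → LoopConfig ℂ) (μ' : Measure Ω')
    (X' : Ω' → LoopConfig ℂ) : blindLawEDist μ' X' μ X ≤ blindLawEDist μ X μ' X' := by
  refine le_iInf fun ε ↦ le_iInf fun hε ↦ le_iInf fun P ↦ le_iInf fun h₁ ↦ le_iInf fun h₂ ↦
    le_iInf fun hP ↦ ?_
  refine blindLawEDist_le_of_coupling hε (P.map Prod.swap) ?_ ?_ ?_
  · rw [Measure.map_map measurable_fst measurable_swap]; exact h₂
  · rw [Measure.map_map measurable_snd measurable_swap]; exact h₁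
  · have e : (Prod.swap : Ω × Ω' → Ω' × Ω) = (MeasurableEquiv.prodComm : Ω × Ω' ≃ᵐ Ω' × Ω) := rfl
    rw [e, MeasurableEquiv.map_apply]
    refine lt_of_le_of_lt (measure_mono ?_) hP
    rintro ⟨a, b⟩ hp hc
    exact hp hc.symm

/-- The blind coupling distance is symmetric. [folklore] -/
theorem blindLawEDist_comm (μ : Measure Ω) (X : Ω → LoopConfig ℂ) (μ' : Measure Ω')
    (X' : Ω' → LoopConfig ℂ) : blindLawEDist μ X μ' X' = blindLawEDist μ' X' μ X :=
  le_antisymm (blindLawEDist_comm_le μ' X' μ X) (blindLawEDist_comm_le μ X μ' X')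

/-- **The blind coupling distance is dominated by DKKMO's coupling distance `d_CN(φ, φ')`**
(eq. (2)): the same couplings are admissible and the blind bad event is smaller
(`IsBlindClose.of_isClose`). [folklore] -/
theorem blindLawEDist_le_cnLawEDist (μ : Measure Ω) (X : Ω → LoopConfig ℂ) (μ' : Measure Ω')
    (X' : Ω' → LoopConfig ℂ) : blindLawEDist μ X μ' X' ≤ cnLawEDist μ X μ' X' := by
  refine le_iInf fun ε ↦ le_iInf fun hε ↦ le_iInf fun P ↦ le_iInf fun h₁ ↦ le_iInf fun h₂ ↦
    le_iInf fun hP ↦ ?_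
  refine blindLawEDist_le_of_coupling hε P h₁ h₂ (lt_of_le_of_lt (measure_mono ?_) hP)
  intro p hp hc
  exact hp (IsBlindClose.of_isClose hc)

end Law

end LoopConfig

end Literature.Probability.RandomPlanarGeometry

end
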